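import Mathlib.RingTheory.RootsOfUnity.Complex
import Mathlib.NumberTheory.Padics.RingHoms
import Literature.NumberTheory.EllipticCurves.NewformGaloisRepProofs
import Literature.NumberTheory.EllipticCurves.NewformGaloisRepModL
import Literature.NumberTheory.EllipticCurves.DeligneSerreWeightOneBound
import Literature.NumberTheory.EllipticCurves.DeligneSerreWeightOneLemmas
import Literature.NumberTheory.GaloisRepresentations.ArtinRepFrobenius
import Literature.NumberTheory.GaloisRepresentations.PadicComplexEmbedding
import Literature.RepresentationTheory.FiniteGroups.CoprimeOrderLift
import HarnessLib

/-!
# Deligne–Serre 1974, §8.5–8.6: proof of Thm. 4.1 (existence) from its constituents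

This file PROVES the named fact `Literature.NumberTheory.EllipticCurves.ModularForms.DeligneSerre1974.thm41_exists`
(`Literature.NumberTheory.EllipticCurves.NewformGaloisRepProofs`; Deligne–Serre 1974, Thm. 4.1
with §3 (a): a weight-one newform `f ∈ S_1(Γ₁(N))` has an attached continuous representation
`Gal(ℚ̄/ℚ) → GL₂(ℂ)` with finite image, unramified outside `N`, with
`charpoly(F_p) = X² − a_p X + ε(p)` for `p ∤ N`) from the inputs of the printed proof
(op. cit. §8), each of which is a named fact of the tree:

* `thm67_weightOne` (op. cit. Thm. 6.7, §8.2): the mod-`ℓ` representations `ρ_ℓ` attached to `f`;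
* `prop55` (op. cit. Prop. 5.5), `Chebotarev.dirichletDensity_eq` (Neukirch VII (13.4)) and
  `prop72` (op. cit. Prop. 7.2), through Lemme 8.4
  (`Literature.NumberTheory.EllipticCurves.DeligneSerreWeightOneBound`): `#ρ_ℓ(Gal) ≤ A`;
* `SerreLRFG.prop43_lift` (Serre, *Représentations linéaires des groupes finis*, §15.5):
  representations of groups of order prime to `ℓ` lift from `𝔽_ℓ` to `ℤ_ℓ` (op. cit. 8.6,
  "argument standard");
* `lemma32_complex` (op. cit. Lemme 3.2): finite-image complex representations with the same
  Frobenius data outside a finite set are isomorphic (op. cit. 8.6, last paragraph);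

together with the standard facts on newforms named in
`Literature.NumberTheory.EllipticCurves.Newforms` / `NewformGaloisRep` (`K_f` is a number
field, `f ∈ S_1(N, ε)`, `T_p f = a_p f`, `a_p ∈ 𝓞_f`), all hypotheses of `thm41_exists_of`.

## The argument (op. cit. 8.5–8.6) as formalised

Let `A` be the bound of Lemme 8.4, `m = A!` (so that every `ρ_ℓ(F_p)` satisfies `g^m = 1`),
`K' = K_f(e^{2πi/m}) ⊂ ℂ` and `ζ ∈ 𝓞_{K'}` this primitive `m`-th root of unity; let `Y` be the
finite set of polynomials `(X − ζ^a)(X − ζ^b)`.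

* (8.5) `map_heckePolynomial_mem`: for `p ∤ N` the Hecke polynomial `P_p = X² − a_p X + ε(p)`
  lies in `Y`. For every prime `ℓ > max(A, p)` admitting `j : 𝓞_{K'} → 𝔽_ℓ` (there are
  infinitely many, `Literature.NumberTheory.GaloisRepresentations.NumberField.exists_prime_gt_padicEmbedding`) the reduction `j(P_p)` is
  the characteristic polynomial of `ρ_ℓ(F_p)`, an element of order dividing `m` of `GL₂(𝔽_ℓ)`,
  hence equals `j(Q)` for some `Q ∈ Y` (`𝔽_ℓ ∋ j(ζ)` a primitive `m`-th root of unity); by the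
  pigeon-hole lemma `mem_of_forall_exists_map_eq` (two algebraic integers congruent modulo
  infinitely many primes are equal), `P_p ∈ Y`.
* (8.6) `exists_isGaloisRepOfNewform1_awayFrom`: for a prime `ℓ > max(A, N)` with compatible
  embeddings `e : 𝓞_{K'} → ℤ_ℓ`, `c : ℚ_ℓ → ℂ`, lift the identical representation of
  `G_ℓ = ρ_ℓ(Gal(ℚ̄/ℚ))` (`ℓ ∤ #G_ℓ ≤ A`) to `θ : G_ℓ → GL₂(ℤ_ℓ)` and put `ρ = c ∘ θ ∘ ρ_ℓ`
  (`exists_complexLift`): finite image, unramified outside `N ℓ`, and for `p ∤ N ℓ` the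
  characteristic polynomial of `θ(ρ_ℓ(F_p))` is `e(Q)`, `Q ∈ Y`, congruent to `e(P_p)` modulo
  `ℓ`; as `m`-th roots of unity stay distinct modulo `ℓ > A`, `Q = P_p`
  (`prod_X_sub_C_eq_of_map_eq`), so `charpoly ρ(F_p) = P_p` in `ℂ[X]`.
* `thm41_exists_of`: doing this for two primes `ℓ₀ ≠ ℓ₁` and comparing by Lemme 3.2 (the two
  representations are semisimple by Maschke) shows that `ρ_{ℓ₀}`'s lift is also unramified
  at `ℓ₀` with the right Frobenius polynomial, i.e. is attached to `f` away from `N`.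

## References

* P. Deligne, J.-P. Serre, *Formes modulaires de poids 1*, Ann. Sci. ÉNS (4) 7 (1974), §8.5,
  §8.6 (p. 526).
-/

noncomputable section

open scoped MatrixGroups NumberField IntermediateField
open CongruenceSubgroup Polynomial IsDedekindDomain Rat.HeightOneSpectrum Matrix

namespace Literature.NumberTheory.EllipticCurves.ModularForms.DeligneSerre1974

/-! ### Preliminaries -/

section Prelim

/-- Two products `(X − x)(X − y)`, `(X − x')(X − y')` of linear factors at `m`-th roots of unity
of a domain `R` which agree under a ring map `j : R → k` to a field with `m ≠ 0` in `k` are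
equal (the `m`-th roots of unity of `R` inject into `k`). This is the comparison
"`P ≡ P_p (mod ℓ)`, both with roots in `μ_m`, hence `P = P_p`" of Deligne–Serre 1974, 8.6.
[folklore] -/
theorem prod_X_sub_C_eq_of_map_eq {R k : Type*} [CommRing R] [IsDomain R] [Field k]
    (j : R →+* k) {m : ℕ} (hm : (m : k) ≠ 0) {ζ : R} (hζ : IsPrimitiveRoot ζ m) {x y x' y' : R}
    (hx : x ^ m = 1) (hy : y ^ m = 1) (hx' : x' ^ m = 1) (hy' : y' ^ m = 1)
    (h : ((X - C x) * (X - C y)).map j = ((X - C x') * (X - C y')).map j) :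
    (X - C x) * (X - C y) = (X - C x') * (X - C y') := by
  have hinj := Literature.NumberTheory.EllipticCurves.DeligneSerre1974.injOn_rootsOfUnity_of_cast_ne_zero hm hζ j
  simp only [Polynomial.map_mul, Polynomial.map_sub, map_X, map_C] at h
  have hroots : (j x ::ₘ {j y} : Multiset k) = j x' ::ₘ {j y'} := by
    have h1 : ∀ a b : k, ((X - C a) * (X - C b)).roots = a ::ₘ {b} := fun a b ↦ by
      rw [roots_mul ((monic_X_sub_C a).mul (monic_X_sub_C b)).ne_zero, roots_X_sub_C,
        roots_X_sub_C, Multiset.singleton_add]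
    rw [← h1, ← h1, h]
  have key : (j x = j x' ∧ j y = j y') ∨ (j x = j y' ∧ j y = j x') := by
    rw [Multiset.cons_eq_cons] at hroots
    rcases hroots with ⟨h1, h2⟩ | ⟨-, cs, h1, h2⟩
    · exact Or.inl ⟨h1, Multiset.singleton_inj.mp h2⟩
    · rw [Multiset.singleton_eq_cons_iff] at h1 h2
      exact Or.inr ⟨h2.1.symm, h1.1⟩
  rcases key with ⟨h1, h2⟩ | ⟨h1, h2⟩
  · rw [hinj hx hx' h1, hinj hy hy' h2]
  · rw [hinj hx hy' h1, hinj hy hx' h2, mul_comm]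

/-- The residue field of `ℤ_ℓ` has characteristic `ℓ`. [folklore] -/
lemma charP_residueField_padicInt (ℓ : ℕ) [Fact ℓ.Prime] :
    CharP (IsLocalRing.ResidueField ℤ_[ℓ]) ℓ :=
  charP_of_injective_ringHom (f := (PadicInt.residueField (p := ℓ)).symm.toRingHom)
    (PadicInt.residueField (p := ℓ)).symm.injective ℓ

/-- `PadicInt.residueField ∘ residue = toZMod`, pointwise. [folklore] -/
lemma residueField_residue (ℓ : ℕ) [Fact ℓ.Prime] (x : ℤ_[ℓ]) :
    PadicInt.residueField (IsLocalRing.residue ℤ_[ℓ] x) = PadicInt.toZMod x := by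
  rw [PadicInt.toZMod_eq_residueField_comp_residue]
  rfl

variable {K : Type*} [Field K] {A : Type*} [CommRing A] [TopologicalSpace A]
  {M : Type*} [AddCommGroup M] [Module A M] [TopologicalSpace M] [Module.Free A M]
  [Module.Finite A M] {M' : Type*} [AddCommGroup M'] [Module A M'] [TopologicalSpace M']
  [Module.Free A M'] [Module.Finite A M']

/-- Frobenius characteristic polynomials are invariant under equivalence of continuous
representations (conjugate endomorphisms have the same characteristic polynomial). [folklore] -/
theorem _root_.Literature.NumberTheory.GaloisRepresentations.GaloisRep.HasFrobCharpolyAt.of_equiv {v : HeightOneSpectrum (𝓞 K)}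
    {P : Polynomial A} {ρ : GaloisRepresentations.GaloisRep K A M} {ρ' : GaloisRepresentations.GaloisRep K A M'}
    (h : ρ.HasFrobCharpolyAt v P) (e : GaloisRepresentations.ContinuousRep.Equiv ρ ρ') : ρ'.HasFrobCharpolyAt v P := by
  intro 𝔓 h𝔓 σ hσ
  rw [← h 𝔓 h𝔓 σ hσ]
  have : (ρ' σ : M' →ₗ[A] M') = e.toLinearEquiv.conj (ρ σ) := by
    refine LinearMap.ext fun w ↦ ?_
    obtain ⟨u, rfl⟩ := e.toLinearEquiv.surjective w
    rw [LinearEquiv.conj_apply]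
    simp only [LinearMap.coe_comp, LinearEquiv.coe_coe, Function.comp_apply,
      LinearEquiv.symm_apply_apply]
    exact (e.apply_apply σ u).symm
  rw [this, LinearEquiv.charpoly_conj]

end Prelim

/-! ### Frobenius characteristic polynomials of attached representations -/

section Attached

variable {N : ℕ} [NeZero N] {k : ℤ} {f : CuspForm (Gamma1 N) k}
  {A : Type*} [CommRing A] [TopologicalSpace A]

/-- `𝓞_f → K_f` is injective, hence so is `𝓞_f[X] → K_f[X]`. [folklore] -/
lemma map_coeffCharIntegers_injective :
    Function.Injective (Polynomial.map (algebraMap (coeffCharIntegers f) (coeffCharField f))) :=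
  Polynomial.map_injective _ (fun _ _ h ↦ Subtype.ext h)

/-- For a representation attached to `f` away from `S` in the integral sense, the characteristic
polynomial of an arithmetic Frobenius at `p ∉ S` is the image of the (unique) integral lift
`P_p ∈ 𝓞_f[X]` of the Hecke polynomial. [folklore] -/
lemma charpoly_eq_map_of_isGaloisRepOfNewform1Int {ι : coeffCharIntegers f →+* A} {S : Set ℕ}
    {ρ : GaloisRepresentations.FramedGaloisRep ℚ A 2} (h : IsGaloisRepOfNewform1Int f ι S ρ)
    (P : ℕ → Polynomial (coeffCharIntegers f))
    (hP : ∀ q, (P q).map (algebraMap (coeffCharIntegers f) (coeffCharField f)) =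
      heckePolynomial f q)
    {v : HeightOneSpectrum (𝓞 ℚ)} (hv : ((primesEquiv v : Nat.Primes) : ℕ) ∉ S)
    {𝔓 : Ideal (GaloisRepresentations.absIntegers (𝓞 ℚ) ℚ)} (h𝔓 : 𝔓 ∈ v.primesAbove)
    {σ : Field.absoluteGaloisGroup ℚ} (hσ : IsArithFrobAt (𝓞 ℚ) σ 𝔓) :
    GaloisRepresentations.FramedRep.charpoly ρ σ = (P (primesEquiv v : Nat.Primes)).map ι := by
  obtain ⟨-, P', hP', hch⟩ := h v hv
  have : P' = P (primesEquiv v : Nat.Primes) :=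
    map_coeffCharIntegers_injective (hP'.trans (hP _).symm)
  subst this
  exact hch 𝔓 h𝔓 σ hσ

end Attached

/-! ### The lift of a mod-`ℓ` representation with small image (op. cit. 8.6) -/

section Lift

variable {ℓ : ℕ} [Fact ℓ.Prime]

/-- **Deligne–Serre 1974, 8.6 ("argument standard").** Let `ρ : Gal(ℚ̄/ℚ) → GL₂(𝔽_ℓ)` be a
continuous representation whose image `G` has order prime to `ℓ`, and `c : ℚ_ℓ → ℂ` a ring
homomorphism. Lifting the identical representation of `G` to `θ : G → GL₂(ℤ_ℓ)`
(`SerreLRFG.prop43_lift`) and composing with `c` gives a continuous representation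
`ρ' : Gal(ℚ̄/ℚ) → GL₂(ℂ)` with finite image, trivial where `ρ` is, such that for every `σ` the
matrix `Θ(σ) = θ(ρ(σ)) ∈ M₂(ℤ_ℓ)` reduces to `ρ(σ)` modulo `ℓ`, satisfies `Θ(σ)^{#G} = 1`, and
`charpoly ρ'(σ) = c(charpoly Θ(σ))`. [cite: DeligneSerreASENS1974, §8.6] -/
theorem exists_complexLift (hlift : Literature.RepresentationTheory.FiniteGroups.SerreLRFG.prop43_lift.{0, 0})
    (c : ℚ_[ℓ] →+* ℂ) (ρ : GaloisRepresentations.FramedGaloisRep ℚ (ZMod ℓ) 2)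
    (hG : ¬ ℓ ∣ Nat.card (ρ : Field.absoluteGaloisGroup ℚ →* GL (Fin 2) (ZMod ℓ)).range) :
    ∃ (ρ' : GaloisRepresentations.FramedGaloisRep ℚ ℂ 2)
      (Θ : Field.absoluteGaloisGroup ℚ → Matrix (Fin 2) (Fin 2) ℤ_[ℓ]),
      (Set.range ρ').Finite ∧
      (∀ σ, ρ σ = 1 → ρ' σ = 1) ∧
      (∀ σ, (Θ σ).map PadicInt.toZMod =
        ((ρ σ : GL (Fin 2) (ZMod ℓ)) : Matrix (Fin 2) (Fin 2) (ZMod ℓ))) ∧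
      (∀ σ, Θ σ ^ Nat.card (ρ : Field.absoluteGaloisGroup ℚ →* GL (Fin 2) (ZMod ℓ)).range = 1) ∧
      (∀ σ, GaloisRepresentations.FramedRep.charpoly ρ' σ =
        (Θ σ).charpoly.map (c.comp (algebraMap ℤ_[ℓ] ℚ_[ℓ]))) := by
  classical
  set Γ := Field.absoluteGaloisGroup ℚ
  set G : Subgroup (GL (Fin 2) (ZMod ℓ)) := (ρ : Γ →* GL (Fin 2) (ZMod ℓ)).range with hGdef
  haveI : CharP (IsLocalRing.ResidueField ℤ_[ℓ]) ℓ := charP_residueField_padicInt ℓ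
  set r : IsLocalRing.ResidueField ℤ_[ℓ] ≃+* ZMod ℓ := PadicInt.residueField with hrdef
  -- the identical representation of `G`, with coefficients in the residue field of `ℤ_ℓ`
  set σG : G →* GL (Fin 2) (IsLocalRing.ResidueField ℤ_[ℓ]) :=
    (Matrix.GeneralLinearGroup.map r.symm.toRingHom).comp G.subtype with hσGdef
  obtain ⟨θ, hθ⟩ := @hlift ℤ_[ℓ] _ _ _ _ _ ℓ _ _ G _ _ hG 2 σG
  -- `ρ' = c ∘ θ ∘ ρ`
  set F : G →* GL (Fin 2) ℂ :=
    (Matrix.GeneralLinearGroup.map (c.comp (algebraMap ℤ_[ℓ] ℚ_[ℓ]))).comp θ with hFdef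
  set ρr : Γ →* G := (ρ : Γ →* GL (Fin 2) (ZMod ℓ)).rangeRestrict with hρrdef
  have hρr_coe : ∀ σ, ((ρr σ : G) : GL (Fin 2) (ZMod ℓ)) = ρ σ := fun σ ↦
    MonoidHom.coe_rangeRestrict _ σ
  have hρr : Continuous ρr := by
    rw [continuous_discrete_rng]
    intro g
    have : ρr ⁻¹' {g} = ρ ⁻¹' {(g : GL (Fin 2) (ZMod ℓ))} := by
      ext σ
      simp only [Set.mem_preimage, Set.mem_singleton_iff, ← hρr_coe, Subtype.coe_inj]
    rw [this]
    exact (isOpen_discrete _).preimage ρ.continuous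
  let ρ' : GaloisRepresentations.FramedGaloisRep ℚ ℂ 2 :=
    ⟨F.comp ρr, (continuous_of_discreteTopology (f := F)).comp hρr⟩
  have hρ'apply : ∀ σ, ρ' σ = F (ρr σ) := fun σ ↦ rfl
  refine ⟨ρ', fun σ ↦ ((θ (ρr σ) : GL (Fin 2) ℤ_[ℓ]) : Matrix (Fin 2) (Fin 2) ℤ_[ℓ]),
    ?_, ?_, ?_, ?_, ?_⟩
  · -- finite image
    refine (Set.finite_range F).subset ?_
    rintro _ ⟨σ, rfl⟩
    exact ⟨ρr σ, rfl⟩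
  · -- trivial where `ρ` is
    intro σ hσ
    have : ρr σ = 1 := Subtype.ext (by rw [hρr_coe, hσ]; rfl)
    rw [hρ'apply, this, map_one]
  · -- reduction modulo `ℓ`
    intro σ
    have h1 : Matrix.GeneralLinearGroup.map (IsLocalRing.residue ℤ_[ℓ]) (θ (ρr σ)) =
        σG (ρr σ) := by
      rw [← hθ]; rfl
    ext i j
    have h2 := congrArg (fun u : GL (Fin 2) (IsLocalRing.ResidueField ℤ_[ℓ]) ↦
      r ((u : Matrix (Fin 2) (Fin 2) _) i j)) h1
    simp only [Matrix.GeneralLinearGroup.map_apply, hσGdef, MonoidHom.comp_apply,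
      Subgroup.subtype_apply, RingEquiv.toRingHom_eq_coe, RingHom.coe_coe,
      RingEquiv.apply_symm_apply] at h2
    rw [Matrix.map_apply, ← residueField_residue, ← hρr_coe]
    exact h2
  · -- finite order
    intro σ
    rw [← Units.val_pow_eq_pow_val, ← map_pow, pow_card_eq_one', map_one, Units.val_one]
  · -- characteristic polynomial
    intro σ
    rw [← Matrix.charpoly_map]
    simp only [GaloisRepresentations.FramedRep.charpoly, hρ'apply, hFdef, MonoidHom.comp_apply]
    congr 1

end Lift

/-! ### The setting of 8.5–8.6 -/

section Setting

variable {N : ℕ} [NeZero N]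

/-- The map `𝓞_f → 𝓞_L` on algebraic integers induced by a ring homomorphism `K_f → L` of the
coefficient field into a field `L` (algebraic integers map to algebraic integers). [folklore] -/
def coeffCharIntegersMap {k : ℤ} (f : CuspForm (Gamma1 N) k) {L : Type*} [Field L]
    (g : coeffCharField f →+* L) : coeffCharIntegers f →+* 𝓞 L :=
  NumberField.RingOfIntegers.mapRingHom g

/-- Unfolding lemma for `coeffCharIntegersMap`. [folklore] -/
@[simp] lemma coeffCharIntegersMap_apply {k : ℤ} (f : CuspForm (Gamma1 N) k) {L : Type*}
    [Field L] (g : coeffCharField f →+* L) (x : coeffCharIntegers f) :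
    ((coeffCharIntegersMap f g x : 𝓞 L) : L) = g x.1 := rfl

/-- The coefficient field with character values `K_f = ℚ(a_n, ε(n))` is a number field as soon
as `ℚ(a_n)` is: the character values are roots of unity (or `0`). [folklore] -/
theorem finiteDimensional_coeffCharField {k : ℤ} (f : CuspForm (Gamma1 N) k)
    [FiniteDimensional ℚ (coeffField f)] : FiniteDimensional ℚ (coeffCharField f) := by
  classical
  set T : Set ℂ := Set.range (fun n : ℕ ↦ (nebentypus f (n : ZMod N) : ℂ)) with hT
  have hTfin : T.Finite :=
    (Set.finite_range (fun x : ZMod N ↦ (nebentypus f x : ℂ))).subset (by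
      rintro _ ⟨n, rfl⟩; exact ⟨(n : ZMod N), rfl⟩)
  haveI : Finite T := hTfin.to_subtype
  have hTint : ∀ x ∈ T, IsIntegral ℚ x := by
    rintro _ ⟨n, rfl⟩
    dsimp only
    by_cases hu : IsUnit (n : ZMod N)
    · obtain ⟨u, hu⟩ := hu
      rw [← hu]
      refine IsIntegral.of_pow (Fintype.card_pos (α := (ZMod N)ˣ)) ?_
      rw [← MulChar.pow_apply_coe, MulChar.pow_card_eq_one, MulChar.one_apply_coe]
      exact isIntegral_one
    · rw [MulChar.map_nonunit _ hu]
      exact isIntegral_zero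
  haveI : FiniteDimensional ℚ (IntermediateField.adjoin ℚ T) :=
    IntermediateField.finiteDimensional_adjoin hTint
  have h := IntermediateField.finiteDimensional_sup (coeffField f) (IntermediateField.adjoin ℚ T)
  rw [coeffField, ← IntermediateField.adjoin_union] at h
  exact h

variable {f : CuspForm (Gamma1 N) 1} {K' : Type} [Field K']

open Classical in
/-- The finite set `Y = {(X − ζ^a)(X − ζ^b) : a, b < m}` of Deligne–Serre 1974, 8.5.
[cite: DeligneSerreASENS1974, §8.5] -/
def rootPairPolys (ζ : 𝓞 K') (m : ℕ) : Finset (Polynomial (𝓞 K')) :=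
  ((Finset.range m) ×ˢ (Finset.range m)).image
    (fun ab : ℕ × ℕ ↦ (X - C (ζ ^ ab.1)) * (X - C (ζ ^ ab.2)))

/-- Membership in `rootPairPolys`. [folklore] -/
lemma mem_rootPairPolys_iff {ζ : 𝓞 K'} {m : ℕ} {Q : Polynomial (𝓞 K')} :
    Q ∈ rootPairPolys ζ m ↔ ∃ a < m, ∃ b < m, Q = (X - C (ζ ^ a)) * (X - C (ζ ^ b)) := by
  classical
  simp only [rootPairPolys, Finset.mem_image, Finset.mem_product, Finset.mem_range, Prod.exists]
  constructor
  · rintro ⟨a, b, ⟨ha, hb⟩, rfl⟩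
    exact ⟨a, ha, b, hb, rfl⟩
  · rintro ⟨a, ha, b, hb, rfl⟩
    exact ⟨a, b, ⟨ha, hb⟩, rfl⟩

/-- **One prime `ℓ` (op. cit. 8.5, first half).** With the bound `A` of Lemme 8.4 and
`m = A!`: for a prime `ℓ > A`, a ring map `j : 𝓞_{K'} → 𝔽_ℓ` and a prime `p ∤ N`, `p ≠ ℓ`,
the reduction of the Hecke polynomial `P_p` under `j` is `j((X − ζ^a)(X − ζ^b))` for some
`a, b` — it is the characteristic polynomial of `ρ_ℓ(F_p)`, an element of the image of the
mod-`ℓ` representation `ρ_ℓ` (Thm. 6.7), a group of order `≤ A`, so dividing `m`.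
[cite: DeligneSerreASENS1974, §8.5] -/
theorem exists_map_heckePolynomial_eq (h67 : thm67_weightOne (N := N)) (hf : IsNewform1 f)
    (incl : coeffCharIntegers f →+* 𝓞 K') (P : ℕ → Polynomial (coeffCharIntegers f))
    (hP : ∀ q, (P q).map (algebraMap (coeffCharIntegers f) (coeffCharField f)) =
      heckePolynomial f q)
    {A : ℕ} (hA : ∀ (ℓ : ℕ) [Fact ℓ.Prime] (ι : coeffCharIntegers f →+* ZMod ℓ)
      (ρ : GaloisRepresentations.FramedGaloisRep ℚ (ZMod ℓ) 2),
      IsGaloisRepOfNewform1Int f ι {p | p ∣ N * ℓ} ρ → ρ.toGaloisRep.IsSemisimple →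
      Nat.card (ρ : Field.absoluteGaloisGroup ℚ →* GL (Fin 2) (ZMod ℓ)).range ≤ A)
    {ζ : 𝓞 K'} (hζ : IsPrimitiveRoot ζ A.factorial)
    {ℓ : ℕ} [Fact ℓ.Prime] (hℓA : A < ℓ) (j : 𝓞 K' →+* ZMod ℓ)
    {p : ℕ} (hp : p.Prime) (hpN : ¬ p ∣ N) (hpℓ : p ≠ ℓ) :
    ∃ a < A.factorial, ∃ b < A.factorial,
      ((P p).map incl).map j = ((X - C (ζ ^ a)) * (X - C (ζ ^ b))).map j := by
  classical
  set m := A.factorial with hmdef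
  haveI : NeZero m := ⟨Nat.factorial_ne_zero A⟩
  have hℓ : ℓ.Prime := Fact.out
  have hm : (m : ZMod ℓ) ≠ 0 := by
    rw [Ne, ZMod.natCast_eq_zero_iff, hmdef, hℓ.dvd_factorial]
    omega
  -- the mod-`ℓ` representation attached to `f` via `ι = j ∘ incl`
  set ι : coeffCharIntegers f →+* ZMod ℓ := j.comp incl with hιdef
  obtain ⟨ρ, hρ, hss⟩ := h67 hf ℓ ι
  set G := (ρ : Field.absoluteGaloisGroup ℚ →* GL (Fin 2) (ZMod ℓ)).range with hGdef
  have hcard : Nat.card G ≤ A := hA ℓ ι ρ hρ hss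
  have hdvd : Nat.card G ∣ m := Nat.dvd_factorial Nat.card_pos hcard
  -- a Frobenius at `p`
  set v : HeightOneSpectrum (𝓞 ℚ) := primesEquiv.symm ⟨p, hp⟩ with hvdef
  have hvp : ((primesEquiv v : Nat.Primes) : ℕ) = p := by simp [hvdef]
  have hv : ((primesEquiv v : Nat.Primes) : ℕ) ∉ {q | q ∣ N * ℓ} := by
    rw [hvp]
    intro h
    rcases (Nat.Prime.dvd_mul hp).mp h with h | h
    · exact hpN h
    · exact hpℓ ((Nat.prime_dvd_prime_iff_eq hp hℓ).mp h)
  obtain ⟨𝔓, h𝔓⟩ := HeightOneSpectrum.primesAbove_nonempty v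
  obtain ⟨σ, hσ⟩ := HeightOneSpectrum.exists_isArithFrobAt_of_mem_primesAbove_holds h𝔓
  have hchar : GaloisRepresentations.FramedRep.charpoly ρ σ = (P p).map ι := by
    rw [← hvp]
    exact charpoly_eq_map_of_isGaloisRepOfNewform1Int hρ P hP hv h𝔓 hσ
  -- `ρ σ` has order dividing `m`
  have hpow : ((ρ σ : GL (Fin 2) (ZMod ℓ)) : Matrix (Fin 2) (Fin 2) (ZMod ℓ)) ^ m = 1 := by
    obtain ⟨d, hd⟩ := hdvd
    have h1 : (⟨ρ σ, σ, rfl⟩ : G) ^ Nat.card G = 1 := pow_card_eq_one'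
    have h2 : (ρ σ) ^ Nat.card G = 1 := by
      have := congrArg Subtype.val h1
      rwa [Subgroup.coe_pow, Subgroup.coe_one] at this
    rw [← Units.val_pow_eq_pow_val, hd, pow_mul, h2, one_pow, Units.val_one]
  obtain ⟨a, ha, b, hb, hab⟩ :=
    Literature.NumberTheory.EllipticCurves.DeligneSerre1974.charpoly_eq_of_pow_eq_one_fin_two
      (Literature.NumberTheory.EllipticCurves.DeligneSerre1974.isPrimitiveRoot_map_of_cast_ne_zero hm hζ j) _ hpow
  refine ⟨a, ha, b, hb, ?_⟩
  rw [Polynomial.map_map, ← hιdef, ← hchar]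
  simp only [GaloisRepresentations.FramedRep.charpoly, hab, Polynomial.map_mul, Polynomial.map_sub, map_X, map_C,
    map_pow, Polynomial.map_pow]

/-- **Deligne–Serre 1974, 8.5.** With the bound `A` of Lemme 8.4, `m = A!` and `ζ ∈ 𝓞_{K'}` a
primitive `m`-th root of unity: if `𝓞_{K'}` admits ring maps to `𝔽_ℓ` for arbitrarily large
primes `ℓ`, then for every prime `p ∤ N` the Hecke polynomial `P_p = X² − a_p X + ε(p)` is of
the form `(X − ζ^a)(X − ζ^b)` ("Comme `Y` est fini, il existe un `R` tel que la congruence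
ci-dessus soit satisfaite pour une infinité de `ℓ`, et l'on a donc l'égalité `R = P_p`").
[cite: DeligneSerreASENS1974, §8.5] -/
theorem map_heckePolynomial_mem (h67 : thm67_weightOne (N := N)) (hf : IsNewform1 f)
    (incl : coeffCharIntegers f →+* 𝓞 K') (P : ℕ → Polynomial (coeffCharIntegers f))
    (hP : ∀ q, (P q).map (algebraMap (coeffCharIntegers f) (coeffCharField f)) =
      heckePolynomial f q)
    {A : ℕ} (hA : ∀ (ℓ : ℕ) [Fact ℓ.Prime] (ι : coeffCharIntegers f →+* ZMod ℓ)
      (ρ : GaloisRepresentations.FramedGaloisRep ℚ (ZMod ℓ) 2),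
      IsGaloisRepOfNewform1Int f ι {p | p ∣ N * ℓ} ρ → ρ.toGaloisRep.IsSemisimple →
      Nat.card (ρ : Field.absoluteGaloisGroup ℚ →* GL (Fin 2) (ZMod ℓ)).range ≤ A)
    {ζ : 𝓞 K'} (hζ : IsPrimitiveRoot ζ A.factorial)
    (hD : ∀ B : ℕ, ∃ ℓ : ℕ, ℓ.Prime ∧ B < ℓ ∧ Nonempty (𝓞 K' →+* ZMod ℓ))
    {p : ℕ} (hp : p.Prime) (hpN : ¬ p ∣ N) :
    (P p).map incl ∈ rootPairPolys ζ A.factorial := by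
  classical
  set L : Set ℕ := {ℓ | ℓ.Prime ∧ max A p < ℓ ∧ Nonempty (𝓞 K' →+* ZMod ℓ)} with hLdef
  have hLinf : L.Infinite := by
    refine Set.infinite_of_forall_exists_gt fun n ↦ ?_
    obtain ⟨ℓ, hℓ, hlt, hne⟩ := hD (max n (max A p))
    exact ⟨ℓ, ⟨hℓ, lt_of_le_of_lt (le_max_right _ _) hlt, hne⟩,
      lt_of_le_of_lt (le_max_left _ _) hlt⟩
  refine Literature.NumberTheory.EllipticCurves.DeligneSerre1974.mem_of_forall_exists_map_eq (R := 𝓞 K') hLinf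
    (fun ℓ hℓ ↦ hℓ.1) (fun ℓ hℓ ↦ Classical.choice hℓ.2.2) fun ℓ hℓ ↦ ?_
  haveI : Fact ℓ.Prime := ⟨hℓ.1⟩
  have hℓA : A < ℓ := lt_of_le_of_lt (le_max_left _ _) hℓ.2.1
  have hpℓ : p ≠ ℓ := (lt_of_le_of_lt (le_max_right _ _) hℓ.2.1).ne
  obtain ⟨a, ha, b, hb, hab⟩ := exists_map_heckePolynomial_eq h67 hf incl P hP hA hζ hℓA
    (Classical.choice hℓ.2.2) hp hpN hpℓ
  exact ⟨_, mem_rootPairPolys_iff.mpr ⟨a, ha, b, hb, rfl⟩, hab⟩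

/-- **Deligne–Serre 1974, 8.6 (one prime `ℓ`).** Keep the notation of `map_heckePolynomial_mem`
and let `φ : K' → ℂ` be an embedding compatible with `𝓞_f ⊂ K_f ⊂ ℂ` through `incl`. Let
`ℓ > A` be a prime with ring maps `e : 𝓞_{K'} → ℤ_ℓ`, `c : ℚ_ℓ → ℂ` such that `c ∘ e = φ`. Then
the lift `ρ = c ∘ θ ∘ ρ_ℓ` of the mod-`ℓ` representation attached to `f` (`exists_complexLift`)
has finite image and is attached to `f` away from `N ℓ` over `ℂ`: it is unramified where `ρ_ℓ`
is, and for `p ∤ N ℓ` the characteristic polynomial `e(Q)` of `θ(ρ_ℓ(F_p))`, `Q ∈ Y`, is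
congruent to `e(P_p)` modulo `ℓ`, hence `Q = P_p` and `charpoly ρ(F_p) = P_p`.
[cite: DeligneSerreASENS1974, §8.6] -/
theorem exists_isGaloisRepOfNewform1_awayFrom (h67 : thm67_weightOne (N := N))
    (hlift : Literature.RepresentationTheory.FiniteGroups.SerreLRFG.prop43_lift.{0, 0}) (hf : IsNewform1 f)
    (φ : K' →+* ℂ) (incl : coeffCharIntegers f →+* 𝓞 K')
    (hincl : ∀ x, φ (algebraMap (𝓞 K') K' (incl x)) =
      algebraMap (coeffCharField f) ℂ (algebraMap (coeffCharIntegers f) (coeffCharField f) x))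
    (P : ℕ → Polynomial (coeffCharIntegers f))
    (hP : ∀ q, (P q).map (algebraMap (coeffCharIntegers f) (coeffCharField f)) =
      heckePolynomial f q)
    {A : ℕ} (hA : ∀ (ℓ : ℕ) [Fact ℓ.Prime] (ι : coeffCharIntegers f →+* ZMod ℓ)
      (ρ : GaloisRepresentations.FramedGaloisRep ℚ (ZMod ℓ) 2),
      IsGaloisRepOfNewform1Int f ι {p | p ∣ N * ℓ} ρ → ρ.toGaloisRep.IsSemisimple →
      Nat.card (ρ : Field.absoluteGaloisGroup ℚ →* GL (Fin 2) (ZMod ℓ)).range ≤ A)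
    {ζ : 𝓞 K'} (hζ : IsPrimitiveRoot ζ A.factorial)
    (hD : ∀ B : ℕ, ∃ ℓ : ℕ, ℓ.Prime ∧ B < ℓ ∧ Nonempty (𝓞 K' →+* ZMod ℓ))
    {ℓ : ℕ} [Fact ℓ.Prime] (hℓA : A < ℓ) (e : 𝓞 K' →+* ℤ_[ℓ]) (c : ℚ_[ℓ] →+* ℂ)
    (hce : ∀ x, c (e x : ℚ_[ℓ]) = φ (algebraMap (𝓞 K') K' x)) :
    ∃ ρ' : GaloisRepresentations.FramedGaloisRep ℚ ℂ 2, (Set.range ρ').Finite ∧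
      IsGaloisRepOfNewform1 f (algebraMap (coeffCharField f) ℂ) {p | p ∣ N * ℓ} ρ' := by
  classical
  set m := A.factorial with hmdef
  haveI : NeZero m := ⟨Nat.factorial_ne_zero A⟩
  have hℓ : ℓ.Prime := Fact.out
  have hm : (m : ZMod ℓ) ≠ 0 := by
    rw [Ne, ZMod.natCast_eq_zero_iff, hmdef, hℓ.dvd_factorial]
    omega
  have halg : ∀ y : ℤ_[ℓ], algebraMap ℤ_[ℓ] ℚ_[ℓ] y = (y : ℚ_[ℓ]) := fun _ ↦ rfl
  -- the mod-`ℓ` representation attached to `f` via `ι = toZMod ∘ e ∘ incl`, and its lift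
  set j : 𝓞 K' →+* ZMod ℓ := PadicInt.toZMod.comp e with hjdef
  set ι : coeffCharIntegers f →+* ZMod ℓ := j.comp incl with hιdef
  obtain ⟨ρ, hρ, hss⟩ := h67 hf ℓ ι
  set G := (ρ : Field.absoluteGaloisGroup ℚ →* GL (Fin 2) (ZMod ℓ)).range with hGdef
  have hcard : Nat.card G ≤ A := hA ℓ ι ρ hρ hss
  have hdvd : Nat.card G ∣ m := Nat.dvd_factorial Nat.card_pos hcard
  have hG : ¬ ℓ ∣ Nat.card G := fun h ↦ by
    have := Nat.le_of_dvd Nat.card_pos h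
    omega
  obtain ⟨ρ', Θ, hfin, hker, hred, hpow, hchar⟩ := exists_complexLift hlift c ρ hG
  -- `e` is injective and `e ζ` is a primitive `m`-th root of unity of `ℚ_ℓ`
  have heinj : Function.Injective e := by
    intro x y hxy
    have h1 := congrArg (fun t : ℤ_[ℓ] ↦ c (t : ℚ_[ℓ])) hxy
    simp only [hce] at h1
    exact NumberField.RingOfIntegers.coe_injective (φ.injective h1)
  have hζq : IsPrimitiveRoot (algebraMap ℤ_[ℓ] ℚ_[ℓ] (e ζ)) m :=
    (hζ.map_of_injective heinj).map_of_injective (IsFractionRing.injective ℤ_[ℓ] ℚ_[ℓ])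
  -- the composite `𝓞_f → 𝓞_{K'} → ℤ_ℓ → ℚ_ℓ → ℂ` is the inclusion
  have hcomp : ((c.comp (algebraMap ℤ_[ℓ] ℚ_[ℓ])).comp e).comp incl =
      (algebraMap (coeffCharField f) ℂ).comp
        (algebraMap (coeffCharIntegers f) (coeffCharField f)) := by
    refine RingHom.ext fun x ↦ ?_
    simp only [RingHom.comp_apply, halg, hce, hincl]
  refine ⟨ρ', hfin, fun v hv ↦ ⟨fun 𝔓 h𝔓 σ hσ ↦ hker σ ((hρ v hv).1 𝔓 h𝔓 σ hσ),
    fun 𝔓 h𝔓 σ hσ ↦ ?_⟩⟩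
  -- the prime `p` below `v`
  set p : ℕ := ((primesEquiv v : Nat.Primes) : ℕ) with hpdef
  have hp : p.Prime := (primesEquiv v).2
  have hpN : ¬ p ∣ N := fun h ↦ hv (Dvd.dvd.mul_right h ℓ)
  -- (1) `charpoly Θ(σ) ≡ P_p (mod ℓ)`
  have h1 : GaloisRepresentations.FramedRep.charpoly ρ σ = (P p).map ι :=
    charpoly_eq_map_of_isGaloisRepOfNewform1Int hρ P hP hv h𝔓 hσ
  have h2 : (Θ σ).charpoly.map PadicInt.toZMod = ((P p).map incl).map j := by
    rw [← Matrix.charpoly_map, hred σ, Polynomial.map_map, ← hιdef, ← h1]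
    rfl
  -- (2) `Θ(σ)` has order dividing `m`, so `charpoly Θ(σ) = e(Q)` with `Q ∈ Y`
  have hΘpow : Θ σ ^ m = 1 := by
    obtain ⟨d, hd⟩ := hdvd
    rw [hd, pow_mul, hpow σ, one_pow]
  have h3 : (Θ σ).map (algebraMap ℤ_[ℓ] ℚ_[ℓ]) ^ m = 1 := by
    rw [show (Θ σ).map (algebraMap ℤ_[ℓ] ℚ_[ℓ]) = (algebraMap ℤ_[ℓ] ℚ_[ℓ]).mapMatrix (Θ σ)
      from rfl, ← map_pow, hΘpow, map_one]
  obtain ⟨a, -, b, -, hab⟩ :=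
    Literature.NumberTheory.EllipticCurves.DeligneSerre1974.charpoly_eq_of_pow_eq_one_fin_two hζq _ h3
  have h4 : (Θ σ).charpoly = ((X - C (ζ ^ a)) * (X - C (ζ ^ b))).map e := by
    apply Polynomial.map_injective (algebraMap ℤ_[ℓ] ℚ_[ℓ]) (IsFractionRing.injective ℤ_[ℓ] ℚ_[ℓ])
    rw [← Matrix.charpoly_map, hab, Polynomial.map_map]
    simp only [Polynomial.map_mul, Polynomial.map_sub, map_X, map_C, map_pow, Polynomial.map_pow,
      RingHom.comp_apply]
  -- (3) `P_p ∈ Y` (8.5)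
  obtain ⟨a', -, b', -, hab'⟩ :=
    mem_rootPairPolys_iff.mp (map_heckePolynomial_mem h67 hf incl P hP hA hζ hD hp hpN)
  -- (4) comparison modulo `ℓ`: `Q = P_p`
  have hroot : ∀ n : ℕ, (ζ ^ n) ^ m = 1 := fun n ↦ by
    rw [← pow_mul, mul_comm, pow_mul, hζ.pow_eq_one, one_pow]
  have h5 : (X - C (ζ ^ a)) * (X - C (ζ ^ b)) = (X - C (ζ ^ a')) * (X - C (ζ ^ b')) := by
    refine prod_X_sub_C_eq_of_map_eq j hm hζ (hroot a) (hroot b) (hroot a') (hroot b') ?_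
    rw [← hab', ← h2, h4, Polynomial.map_map, hjdef]
  -- (5) conclusion
  rw [hchar σ, h4, h5, ← hab', Polynomial.map_map, Polynomial.map_map, hcomp,
    ← Polynomial.map_map, hP]

/-! ### Thm. 4.1 (existence) -/

/-- **Deligne–Serre 1974, Thm. 4.1 (existence, with §3 (a)), assembled from its printed
constituents (op. cit. §8.2–8.6).** For a newform `f ∈ S_1(Γ₁(N))` there is a continuous
representation `Gal(ℚ̄/ℚ) → GL₂(ℂ)` with finite image attached to `f` away from `N`
(`thm41_exists`), granted: the mod-`ℓ` representations of Thm. 6.7, Rankin's Prop. 5.5,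
Prop. 7.2, Chebotarev's density theorem, the lifting of prime-to-`ℓ` representations (Serre,
*Représentations linéaires*, §15.5), Lemme 3.2, and the standard newform facts (`K_f` is a
number field, `f ∈ S_1(N, ε)`, `T_p f = a_p f`, `a_p, ε(p) ∈ 𝓞_f`). Two primes `ℓ₀ < ℓ₁`
beyond `max(A, N)` are used (`exists_isGaloisRepOfNewform1_awayFrom`), and Lemme 3.2 transports
unramifiedness and the Frobenius polynomial at `ℓ₀` from the second lift to the first.
[cite: DeligneSerreASENS1974, Thm. 4.1, §8.6] -/
theorem thm41_exists_of (h67 : thm67_weightOne (N := N)) (h55 : prop55)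
    (h72 : Literature.NumberTheory.GaloisRepresentations.DeligneSerre1974.prop72) (hCheb : LFunctions.Chebotarev.dirichletDensity_eq.{0})
    (hlift : Literature.RepresentationTheory.FiniteGroups.SerreLRFG.prop43_lift.{0, 0})
    (h32 : Literature.NumberTheory.GaloisRepresentations.DeligneSerre1974.lemma32_complex)
    (hfd : IsNewform1.finiteDimensional_coeffField (N := N) (k := 1))
    (hneb : IsNewform1.mem_nebentypusSubspace_nebentypus (N := N) (k := 1))
    (heig : IsNewform1.heckeEigenvalue_eq_coeff (N := N) (k := 1))
    (hint : ∀ f : CuspForm (Gamma1 N) 1, IsNewform1.exists_map_eq_heckePolynomial (f := f)) :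
    thm41_exists (N := N) := by
  intro f hf
  classical
  -- Lemme 8.4 and the integral Hecke polynomials
  obtain ⟨A, hA⟩ := exists_card_range_le h55 h72 hCheb hneb heig hf
  choose P hP using hint f hf le_rfl
  -- the number field `K' = K_f(e^{2πi/m}) ⊂ ℂ`, `m = A!`
  haveI : FiniteDimensional ℚ (coeffField f) := hfd hf
  haveI : FiniteDimensional ℚ (coeffCharField f) := finiteDimensional_coeffCharField f
  set m := A.factorial with hmdef
  have hm0 : m ≠ 0 := Nat.factorial_ne_zero A
  set z : ℂ := Complex.exp (2 * Real.pi * Complex.I / m) with hzdef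
  have hz : IsPrimitiveRoot z m := Complex.isPrimitiveRoot_exp m hm0
  have hzint : IsIntegral ℤ z := hz.isIntegral (Nat.pos_of_ne_zero hm0)
  set K' : IntermediateField ℚ ℂ := coeffCharField f ⊔ ℚ⟮z⟯ with hK'def
  haveI : FiniteDimensional ℚ ℚ⟮z⟯ := IntermediateField.adjoin.finiteDimensional hzint.tower_top
  haveI : FiniteDimensional ℚ K' := IntermediateField.finiteDimensional_sup _ _
  haveI : NumberField K' := NumberField.mk
  have hle : coeffCharField f ≤ K' := le_sup_left
  have hzK' : z ∈ K' := (le_sup_right : ℚ⟮z⟯ ≤ K') (IntermediateField.mem_adjoin_simple_self ℚ z)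
  set φ : K' →+* ℂ := algebraMap K' ℂ with hφdef
  set incl : coeffCharIntegers f →+* 𝓞 K' :=
    coeffCharIntegersMap f (IntermediateField.inclusion hle).toRingHom with hincldef
  have hincl : ∀ x, φ (algebraMap (𝓞 K') K' (incl x)) =
      algebraMap (coeffCharField f) ℂ (algebraMap (coeffCharIntegers f) (coeffCharField f) x) :=
    fun x ↦ rfl
  -- `ζ ∈ 𝓞_{K'}`, a primitive `m`-th root of unity
  have hzint' : IsIntegral ℤ (⟨z, hzK'⟩ : K') :=
    (isIntegral_algHom_iff (algebraMap K' ℂ).toIntAlgHom (algebraMap K' ℂ).injective).mp hzint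
  set ζ : 𝓞 K' := ⟨⟨z, hzK'⟩, hzint'⟩ with hζdef
  have hζ : IsPrimitiveRoot ζ m := by
    refine IsPrimitiveRoot.of_map_of_injective
      (f := (algebraMap K' ℂ).comp (algebraMap (𝓞 K') K')) ?_
      ((algebraMap K' ℂ).injective.comp NumberField.RingOfIntegers.coe_injective)
    exact hz
  -- primes `ℓ` with compatible embeddings `𝓞_{K'} → ℤ_ℓ`, `ℚ_ℓ → ℂ`
  have hD' := Literature.NumberTheory.GaloisRepresentations.NumberField.exists_prime_gt_padicEmbedding K' φ
  have hD : ∀ B : ℕ, ∃ ℓ : ℕ, ℓ.Prime ∧ B < ℓ ∧ Nonempty (𝓞 K' →+* ZMod ℓ) := fun B ↦ by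
    obtain ⟨ℓ, hℓ, hB, e, -, -⟩ := hD' B
    haveI := Fact.mk hℓ
    exact ⟨ℓ, hℓ, hB, ⟨PadicInt.toZMod.comp e⟩⟩
  -- two primes `ℓ₀ < ℓ₁` beyond `max A N` and the two lifts
  obtain ⟨ℓ₀, hℓ₀, hB₀, e₀, c₀, hce₀⟩ := hD' (max A N)
  haveI := Fact.mk hℓ₀
  obtain ⟨ρ₀, hfin₀, hρ₀⟩ := exists_isGaloisRepOfNewform1_awayFrom h67 hlift hf φ incl hincl P
    hP hA hζ hD (lt_of_le_of_lt (le_max_left _ _) hB₀) e₀ c₀ hce₀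
  obtain ⟨ℓ₁, hℓ₁, hB₁, e₁, c₁, hce₁⟩ := hD' (max A ℓ₀)
  haveI := Fact.mk hℓ₁
  obtain ⟨ρ₁, hfin₁, hρ₁⟩ := exists_isGaloisRepOfNewform1_awayFrom h67 hlift hf φ incl hincl P
    hP hA hζ hD (lt_of_le_of_lt (le_max_left _ _) hB₁) e₁ c₁ hce₁
  have hℓ₀₁ : ℓ₀ < ℓ₁ := lt_of_le_of_lt (le_max_right _ _) hB₁
  -- Lemme 3.2: `ρ₀ ≃ ρ₁`
  have hS : ({q : ℕ | q ∣ N * ℓ₀ * ℓ₁}).Finite := by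
    refine (Set.finite_Iic (N * ℓ₀ * ℓ₁)).subset fun q hq ↦ Nat.le_of_dvd ?_ hq
    exact Nat.pos_of_ne_zero (mul_ne_zero (mul_ne_zero (NeZero.ne N) hℓ₀.ne_zero) hℓ₁.ne_zero)
  have hagree : ∀ v : HeightOneSpectrum (𝓞 ℚ),
      ((primesEquiv v : Nat.Primes) : ℕ) ∉ {q : ℕ | q ∣ N * ℓ₀ * ℓ₁} →
      ρ₀.IsUnramifiedAt v ∧ ρ₁.IsUnramifiedAt v ∧
        ∃ Q : Polynomial ℂ, ρ₀.HasFrobCharpolyAt v Q ∧ ρ₁.HasFrobCharpolyAt v Q := by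
    intro v hv
    have hv₀ : ((primesEquiv v : Nat.Primes) : ℕ) ∉ {q | q ∣ N * ℓ₀} :=
      fun h ↦ hv (Dvd.dvd.mul_right h ℓ₁)
    have hv₁ : ((primesEquiv v : Nat.Primes) : ℕ) ∉ {q | q ∣ N * ℓ₁} :=
      fun h ↦ hv (by rw [mul_right_comm]; exact Dvd.dvd.mul_right h ℓ₀)
    exact ⟨(hρ₀ v hv₀).1, (hρ₁ v hv₁).1, _, (hρ₀ v hv₀).2, (hρ₁ v hv₁).2⟩
  obtain ⟨eqv⟩ := h32.of_finite hS ρ₀ ρ₁ hfin₀ hfin₁ (isSemisimple_of_finite_range ρ₀ hfin₀)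
    (isSemisimple_of_finite_range ρ₁ hfin₁) hagree
  -- `ρ₀` is attached to `f` away from `N`
  refine ⟨ρ₀, fun v hv ↦ ?_, hfin₀⟩
  have hp : ((primesEquiv v : Nat.Primes) : ℕ).Prime := (primesEquiv v).2
  by_cases hpℓ₀ : ((primesEquiv v : Nat.Primes) : ℕ) = ℓ₀
  · -- at `ℓ₀`: use `ρ₁` and transport along `ρ₀ ≃ ρ₁`
    have hv₁ : ((primesEquiv v : Nat.Primes) : ℕ) ∉ {q | q ∣ N * ℓ₁} := by
      intro h
      rcases (Nat.Prime.dvd_mul hp).mp h with h | h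
      · exact hv h
      · rw [hpℓ₀] at h
        exact hℓ₀₁.ne ((Nat.prime_dvd_prime_iff_eq hℓ₀ hℓ₁).mp h)
    obtain ⟨hunr₁, hchar₁⟩ := hρ₁ v hv₁
    refine ⟨?_, ?_⟩
    · rw [← GaloisRepresentations.FramedGaloisRep.isUnramifiedAt_toGaloisRep_iff] at hunr₁ ⊢
      exact hunr₁.of_equiv eqv.symm
    · rw [← GaloisRepresentations.FramedGaloisRep.hasFrobCharpolyAt_toGaloisRep_iff] at hchar₁ ⊢
      exact hchar₁.of_equiv eqv.symm
  · have hv₀ : ((primesEquiv v : Nat.Primes) : ℕ) ∉ {q | q ∣ N * ℓ₀} := by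
      intro h
      rcases (Nat.Prime.dvd_mul hp).mp h with h | h
      · exact hv h
      · exact hpℓ₀ ((Nat.prime_dvd_prime_iff_eq hp hℓ₀).mp h)
    exact hρ₀ v hv₀

end Setting

end Literature.NumberTheory.EllipticCurves.ModularForms.DeligneSerre1974
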